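import Summits.SmoothPoincare4.SmoothPoincare4.Theorems.ConvexBisectionAcyclicBisectionExistsBeltPageTubePrep
import Summits.SmoothPoincare4.SmoothPoincare4.Theorems.ConvexBisectionAcyclicBisectionExistsBeltTubePushoff
import HarnessLib

/-!
# From the end of the belt-circle slide to the page push-off, in `∂X` (stages (3a)+(3c)+(3d) of node T3c-1′, glued)
(node T3c-1′ `node_belt_isotopic_pushoff` of the sub-goal T3 of stub `stub_steinRealisation` (NF6), line
`modp-braid-orbits`, crux `ConvexBisection.AcyclicBisectionExists`, item stmt-SmoothPoincare4-10508;
wave 4, worker Y1, lead c5; assembly part 1, registered sub-goal `helper_belt_slideToPushoff`)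

For the `j`-th handle of a Lefschetz link `h` on `Base g` (multi-attachment data `D` on `X = Base g ∪ handles`)
and Z4's page tube `Φ` around `K = (h j).attachingCircle` (CORE and FIBRE DERIVATIVE clauses of
`helper_exists_pageTube`), this file concatenates IN `∂X`:

* Z5's `helper_belt_slideToTube` (stages (3a)+(3c): from V6's end framed knot
  `(θ ↦ jA (h̄ⱼ (tubeLongitudePt b r θ)), d(jA) dh̄ⱼ Dι⁻¹ W)` to `jA` of the explicit framed longitude of the second tube
  `Φ₃ = shrinkTube (twistTube Φ σ) μ` of `helper_belt_pageTube_prep` — the twist `σ = t_j` makes the glue hypotheses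
  `hcore / hsgn / hang` hold, the shrink `μ` makes the target small), and
* Y2's `exists_pushoffIsotopy` (stage (3d): inside the shrunk page tube `Φ' = shrinkTube Φ μ`,
  `Φ₃ (ψ, v) = Φ' (ψ, fibreRot σ ψ v)`, under the winding condition `σ s slideSign b = -1` fixed by the choice of the
  slide direction `b`: from that framed longitude to the PAGE PUSH-OFF `θ ↦ Φ' (uDir b θ, -η' e₁)` with its fibre
  framing `d/dε|₀ Φ' (uDir b θ, -η' e₁ + ε reflFibre s θ)`), pushed through `jA` (`…BeltBasePush.lean`; every stage is
  `jA` of a tube point off the zero section, hence off all cores, `tube_mem_coresComplement`).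

Result `exists_slideEnd_to_pushoff`: for all small `r` and all push-off depths `η' ∈ (0, 1)`, a `KnotIsotopyInBoundary`
of `X` from V6's end knot to `jA` of the page push-off, carrying V6's end framing to `d(jA)` of the push-off fibre
framing, ALL STAGES `jA` of points of `range (h j)` off the cores (the link condition of the assembly: these sets are
pairwise disjoint over `j`); and the push-off with its fibre framing is a framed knot of `∂ Base g` (the input of the
rotation phase, `…BeltPushoffRotation.lean`).  The registered helper `helper_belt_slideToPushoff` is the framing-free part (the full
statement exceeds the registration limit and rides along).

Everything is proved; no named facts, no `sorry`.

## References
* A. A. Kosinski, *Differential Manifolds*, Academic Press (1993), III (3.5), VI §6. [Kosinski1993]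
-/

noncomputable section

-- the prescribed namespace `Summit.<P>.<Sub>.…` duplicates `SmoothPoincare4` (P = Sub)
set_option linter.dupNamespace false

open scoped Manifold ContDiff Topology
open Set Function Metric Filter

namespace Summit.SmoothPoincare4.SmoothPoincare4.Theorems.AcyclicBisectionExists.ModpBraidOrbits

open Literature.Topology.FourManifolds Literature.Topology.FourManifolds.LefschetzBase
  Literature.Topology.FourManifolds.HandleAttachingMap Literature.Geometry.Symplectic

variable {g : ℕ}

/-! ### §1 The core of the page tube lies in the quarter tube of the handle -/

/-- The core of Z4's page tube is the core of the boundary tube of the handle. [folklore] -/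
theorem pageTube_core_eq (f : HandleAttachingMap 3 2 (Base g)) (Φ : CircleTube (bBase g).carrier)
    (hΦcore : ∀ ψ, (bBase g).incl (Φ.core ψ) = f.attachingCircle ψ) (θ : sphere (0 : EuclideanSpace ℝ (Fin 2)) 1) :
    Φ.core θ = f.boundaryTube.core θ :=
  Subtype.ext ((hΦcore θ).trans (HandleAttachingMap.coe_boundaryTube_core f θ).symm)

/-- The core of Z4's page tube lies in the quarter tube `f♭ (𝕊¹ × B(0, 1/4))` of the handle. [folklore] -/
theorem pageTube_core_mem_quarter (f : HandleAttachingMap 3 2 (Base g)) (Φ : CircleTube (bBase g).carrier)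
    (hΦcore : ∀ ψ, (bBase g).incl (Φ.core ψ) = f.attachingCircle ψ) (θ : sphere (0 : EuclideanSpace ℝ (Fin 2)) 1) :
    Φ.core θ ∈ f.boundaryTube.toHomeo '' ((univ : Set (sphere (0 : EuclideanSpace ℝ (Fin 2)) 1)) ×ˢ
      ball (0 : EuclideanSpace ℝ (Fin 2)) (1 / 4)) := by
  rw [pageTube_core_eq f Φ hΦcore θ, CircleTube.core_apply]
  exact ⟨(θ, 0), ⟨mem_univ _, by simp⟩, rfl⟩

/-- The quarter tube lies in the target of the boundary tube. [folklore] -/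
theorem quarter_subset_target (f : HandleAttachingMap 3 2 (Base g)) :
    f.boundaryTube.toHomeo '' ((univ : Set (sphere (0 : EuclideanSpace ℝ (Fin 2)) 1)) ×ˢ ball (0 : EuclideanSpace ℝ (Fin 2)) (1 / 4)) ⊆
      f.boundaryTube.toHomeo.target := by
  rintro p ⟨⟨θ, w⟩, ⟨-, hw⟩, rfl⟩
  rw [mem_ball_zero_iff] at hw
  exact f.boundaryTube.toHomeo.map_source (f.boundaryTube.mem_source_iff.2 (by linarith))

/-! ### §2 From the end of the slide to the page push-off, in `∂X` -/

/-- **Stages (3a)+(3c)+(3d) in `∂X`** (full statement; see the module docstring).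
[cite: Kosinski1993, III (3.5) and VI §6] -/
theorem exists_slideEnd_to_pushoff : 
    ∀ {X : Type} [TopologicalSpace X] [T2Space X] [ChartedSpace (EuclideanHalfSpace 4) X] [IsManifold (𝓡∂ 4) ∞ X] (g : ℕ) (l : List ((Fin g ⊕ Fin g → ℤ) × Bool)) (h : Fin l.length → Literature.Topology.FourManifolds.HandleAttachingMap 3 2 (Literature.Topology.FourManifolds.LefschetzBase.Base g)), Literature.Topology.FourManifolds.LefschetzBase.IsLefschetzLink g l h → ∀ (D : Literature.Topology.FourManifolds.HandleAttachingMap.MultiAttachmentData h (𝓡∂ 4) X) (j : Fin l.length) (κ r : ℝ) (Φ : Literature.Topology.FourManifolds.CircleTube (Literature.Topology.FourManifolds.LefschetzBase.bBase g).carrier), 0 < κ → 0 < r → (∀ ψ, (Literature.Topology.FourManifolds.LefschetzBase.bBase g).incl (Φ.core ψ) = (h j).attachingCircle ψ) → (∀ t : ℝ, HasFDerivAt (fun v : EuclideanSpace ℝ (Fin 2) => ((Literature.Topology.FourManifolds.LefschetzBase.bBase g).incl (Φ.toHomeo (Literature.Topology.FourManifolds.circlePt t, v))).1) ((EuclideanSpace.proj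 (𝕜 := ℝ) (0 : Fin 2)).smulRight (r • Literature.Topology.FourManifolds.LefschetzBase.cplxJ (deriv (Literature.Topology.FourManifolds.LefschetzBase.ambCurve g (h j).attachingCircle) t)) + (EuclideanSpace.proj (𝕜 := ℝ) (1 : Fin 2)).smulRight (κ • Summit.SmoothPoincare4.SmoothPoincare4.Theorems.AcyclicBisectionExists.ModpBraidOrbits.rotField g ((h j).attachingCircle (Literature.Topology.FourManifolds.circlePt t)).1)) 0) → ∃ (σ : ℝ) (s : ℝ) (b : Bool) (μ : ℝ) (hμ : 0 < μ) (hμ1 : μ ≤ 1) (r₀ : ℝ), σ = (if (l.get j).2 then -1 else 1) ∧ σ ^ 2 = 1 ∧ s ^ 2 = 1 ∧ σ * s * Summit.SmoothPoincare4.SmoothPoincare4.Theorems.AcyclicBisectionExists.ModpBraidOrbits.slideSign b = -1 ∧ (Summit.SmoothPoincare4.SmoothPoincare4.Theorems.AcyclicBisectionExists.ModpBraidOrbits.shrinkTube Φ hμ hμ1).toHomeo.target ⊆ (h j).boundaryTube.toHomeo '' ((Set.univ : Set (Metric.sphere (0 : EuclideanSpace ℝ (Fin 2)) 1)) ×ˢ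 Metric.ball (0 : EuclideanSpace ℝ (Fin 2)) (1 / 4)) ∧ 0 < r₀ ∧ r₀ ≤ 1 / 4 ∧ ∀ r η' : ℝ, 0 < r → r < r₀ → 0 < η' → η' < 1 → Literature.Geometry.Symplectic.IsBoundaryKnot (fun θ : Metric.sphere (0 : EuclideanSpace ℝ (Fin 2)) 1 => ((Literature.Topology.FourManifolds.LefschetzBase.bBase g).incl ((Summit.SmoothPoincare4.SmoothPoincare4.Theorems.AcyclicBisectionExists.ModpBraidOrbits.shrinkTube Φ hμ hμ1).toHomeo (Summit.SmoothPoincare4.SmoothPoincare4.Theorems.AcyclicBisectionExists.ModpBraidOrbits.uDir b θ, (-η') • Literature.Topology.FourManifolds.planeE1)) : Literature.Topology.FourManifolds.LefschetzBase.Base g)) ∧ Literature.Geometry.Symplectic.IsKnotFraming (fun θ : Metric.sphere (0 : EuclideanSpace ℝ (Fin 2)) 1 => ((Literature.Topology.FourManifolds.LefschetzBase.bBase g).incl ((Summit.SmoothPoincare4.SmoothPoincare4.Theorems.AcyclicBisectionExists.ModpBraidOrbits.shrinkTube Φ hμ hμ1).toHomeo (Summit.SmoothPoincare4.SmoothPoincare4.Theorems.AcyclicBisectionExists.ModpBraidOrbits.uDir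 b θ, (-η') • Literature.Topology.FourManifolds.planeE1)) : Literature.Topology.FourManifolds.LefschetzBase.Base g)) (fun θ : Metric.sphere (0 : EuclideanSpace ℝ (Fin 2)) 1 => mfderiv 𝓘(ℝ, ℝ) (𝓡∂ 4) (fun ε : ℝ => ((Literature.Topology.FourManifolds.LefschetzBase.bBase g).incl ((Summit.SmoothPoincare4.SmoothPoincare4.Theorems.AcyclicBisectionExists.ModpBraidOrbits.shrinkTube Φ hμ hμ1).toHomeo (Summit.SmoothPoincare4.SmoothPoincare4.Theorems.AcyclicBisectionExists.ModpBraidOrbits.uDir b θ, (-η') • Literature.Topology.FourManifolds.planeE1 + ε • Summit.SmoothPoincare4.SmoothPoincare4.Theorems.AcyclicBisectionExists.ModpBraidOrbits.reflFibre s (θ : EuclideanSpace ℝ (Fin 2)))) : Literature.Topology.FourManifolds.LefschetzBase.Base g)) 0 (1 : ℝ)) ∧ ∃ (hmem : ∀ θ : Metric.sphere (0 : EuclideanSpace ℝ (Fin 2)) 1, (h j).toFun (Summit.SmoothPoincare4.SmoothPoincare4.Theorems.AcyclicBisectionExists.ModpBraidOrbits.tubeLongitudePt b r θ) ∈ Literature.Topology.FourManifolds.HandleAttachingMap.coresComplement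 h) (hmem' : ∀ θ : Metric.sphere (0 : EuclideanSpace ℝ (Fin 2)) 1, ((Literature.Topology.FourManifolds.LefschetzBase.bBase g).incl ((Summit.SmoothPoincare4.SmoothPoincare4.Theorems.AcyclicBisectionExists.ModpBraidOrbits.shrinkTube Φ hμ hμ1).toHomeo (Summit.SmoothPoincare4.SmoothPoincare4.Theorems.AcyclicBisectionExists.ModpBraidOrbits.uDir b θ, (-η') • Literature.Topology.FourManifolds.planeE1)) : Literature.Topology.FourManifolds.LefschetzBase.Base g) ∈ Literature.Topology.FourManifolds.HandleAttachingMap.coresComplement h) (Ψ : Literature.Geometry.Symplectic.KnotIsotopyInBoundary (fun θ => D.jA ⟨(h j).toFun (Summit.SmoothPoincare4.SmoothPoincare4.Theorems.AcyclicBisectionExists.ModpBraidOrbits.tubeLongitudePt b r θ), hmem θ⟩) (fun θ => D.jA ⟨(Literature.Topology.FourManifolds.LefschetzBase.bBase g).incl ((Summit.SmoothPoincare4.SmoothPoincare4.Theorems.AcyclicBisectionExists.ModpBraidOrbits.shrinkTube Φ hμ hμ1).toHomeo (Summit.SmoothPoincare4.SmoothPoincare4.Theorems.AcyclicBisectionExists.ModpBraidOrbits.uDir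 b θ, (-η') • Literature.Topology.FourManifolds.planeE1)), hmem' θ⟩)) (νt : ℝ → Metric.sphere (0 : EuclideanSpace ℝ (Fin 2)) 1 → EuclideanSpace ℝ (Fin 4)), (∀ t θ, ∃ a : ↥(Literature.Topology.FourManifolds.HandleAttachingMap.coresComplement h), (a : Literature.Topology.FourManifolds.LefschetzBase.Base g) ∈ Set.range (h j).toFun ∧ Ψ.toFun t θ = D.jA a) ∧ Literature.Geometry.Symplectic.IsFramingAlong Ψ (fun θ => mfderiv (𝓡∂ 4) (𝓡∂ 4) (fun a : ↥(Literature.Topology.FourManifolds.HandleAttachingMap.coresComplement h) => D.jA a) ⟨(h j).toFun (Summit.SmoothPoincare4.SmoothPoincare4.Theorems.AcyclicBisectionExists.ModpBraidOrbits.tubeLongitudePt b r θ), hmem θ⟩ (mfderiv (𝓡∂ 4) (𝓡∂ 4) (h j).toFun (Summit.SmoothPoincare4.SmoothPoincare4.Theorems.AcyclicBisectionExists.ModpBraidOrbits.tubeLongitudePt b r θ) ((Literature.Topology.FourManifolds.closedBallCoeDeriv ((Summit.SmoothPoincare4.SmoothPoincare4.Theorems.AcyclicBisectionExists.ModpBraidOrbits.tubeLongitudePt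 b r θ : ↥(Literature.Topology.FourManifolds.handleTube 3 2)) : Metric.closedBall (0 : EuclideanSpace ℝ (Fin 4)) 1)).symm (Summit.SmoothPoincare4.SmoothPoincare4.Theorems.AcyclicBisectionExists.ModpBraidOrbits.slideEndVec b r θ)))) νt ∧ ∀ θ, νt 1 θ = mfderiv (𝓡∂ 4) (𝓡∂ 4) D.jA ⟨(Literature.Topology.FourManifolds.LefschetzBase.bBase g).incl ((Summit.SmoothPoincare4.SmoothPoincare4.Theorems.AcyclicBisectionExists.ModpBraidOrbits.shrinkTube Φ hμ hμ1).toHomeo (Summit.SmoothPoincare4.SmoothPoincare4.Theorems.AcyclicBisectionExists.ModpBraidOrbits.uDir b θ, (-η') • Literature.Topology.FourManifolds.planeE1)), hmem' θ⟩ (mfderiv 𝓘(ℝ, ℝ) (𝓡∂ 4) (fun ε : ℝ => ((Literature.Topology.FourManifolds.LefschetzBase.bBase g).incl ((Summit.SmoothPoincare4.SmoothPoincare4.Theorems.AcyclicBisectionExists.ModpBraidOrbits.shrinkTube Φ hμ hμ1).toHomeo (Summit.SmoothPoincare4.SmoothPoincare4.Theorems.AcyclicBisectionExists.ModpBraidOrbits.uDir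 b θ, (-η') • Literature.Topology.FourManifolds.planeE1 + ε • Summit.SmoothPoincare4.SmoothPoincare4.Theorems.AcyclicBisectionExists.ModpBraidOrbits.reflFibre s (θ : EuclideanSpace ℝ (Fin 2)))) : Literature.Topology.FourManifolds.LefschetzBase.Base g)) 0 (1 : ℝ)) := by
  intro X _ _ _ _ g l h hlink D j κ r Φ hκ hr hΦcore hΦder
  -- the open neighbourhood: the quarter tube of the handle
  have hO := isOpen_boundaryTube_quarter (h j)
  have hcO := pageTube_core_mem_quarter (h j) Φ hΦcore
  obtain ⟨σ, hσ, s, b, μ, hμ, hμ1, hσj, hs, hb, hsub', hsub₃, hcore₃, hsgn₃, β, hβ, hang₃⟩ :=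
    helper_belt_pageTube_prep g l h hlink j κ r Φ hκ hr hΦcore hΦder _ hO hcO
  -- Z5: stages (3a)+(3c) against `Φ₃`
  obtain ⟨r₀, hr₀, hr₀4, HZ⟩ := exists_slideEnd_to_tube D j b hcore₃ hs hsgn₃ hβ hang₃ hsub₃
  refine ⟨σ, s, b, μ, hμ, hμ1, r₀, hσj, hσ, hs, hb, hsub', hr₀, hr₀4, fun r η' h0 hr0 hη0 hη1 => ?_⟩
  obtain ⟨hmem, hmem₃, ΨZ, νtZ, hcZ, hfrZ, hendZ⟩ := HZ r h0 hr0
  have hr1 : r < 1 := by linarith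
  -- Y2: stage (3d) inside `Φ' = shrinkTube Φ μ`
  have hrel : ∀ (ψ : sphere (0 : EuclideanSpace ℝ (Fin 2)) 1) (v : EuclideanSpace ℝ (Fin 2)),
      (bBase g).incl ((shrinkTube (twistTube Φ σ hσ) hμ hμ1).toHomeo (ψ, v)) =
        tubePt (shrinkTube Φ hμ hμ1) (ψ, (1 : ℝ) • fibreRot σ (ψ : EuclideanSpace ℝ (Fin 2)) v) :=
    shrinkTube_twistTube_apply Φ hσ hμ hμ1
  obtain ⟨ΨY, νtY, hstY, hfrY, hendY⟩ := exists_pushoffIsotopy (W := Base g) (shrinkTube Φ hμ hμ1)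
    (shrinkTube (twistTube Φ σ hσ) hμ hμ1) one_pos le_rfl hrel b hs hb h0 hr1 hη0 hη1
  -- all stages of (3d) are tube points off the zero section, hence off the cores and inside `range (h j)`
  have htarget : (shrinkTube Φ hμ hμ1).toHomeo.target ⊆ (h j).boundaryTube.toHomeo.target :=
    hsub'.trans (quarter_subset_target (h j))
  have hcore' : ∀ ψ, (bBase g).incl ((shrinkTube Φ hμ hμ1).core ψ) = (h j).attachingCircle ψ := fun ψ => by
    rw [shrinkTube_core]; exact hΦcore ψ
  have hwt : ∀ t : ℝ, (((1 * r) * Real.cos (Real.pi / 2 * t)) • planeE0 +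
      (-(η' * Real.sin (Real.pi / 2 * t))) • planeE1 : EuclideanSpace ℝ (Fin 2)) ≠ 0 := fun t =>
    pushoffFibre_ne_zero (by rw [one_mul]; exact h0) hη0 t
  have hwt1 : ∀ t : ℝ, ‖(((1 * r) * Real.cos (Real.pi / 2 * t)) • planeE0 +
      (-(η' * Real.sin (Real.pi / 2 * t))) • planeE1 : EuclideanSpace ℝ (Fin 2))‖ < 1 := fun t =>
    norm_pushoffFibre_lt (by rw [one_mul]; exact h0.le) (by rw [one_mul]; exact hr1) hη0.le hη1 t
  have hcY : ∀ t u, ΨY.toFun t u ∈ coresComplement h ∧ ΨY.toFun t u ∈ range (h j).toFun := by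
    intro t u
    rw [hstY t u]
    exact tube_mem_coresComplement hlink.disjoint j (shrinkTube Φ hμ hμ1) hcore' htarget
      ((shrinkTube Φ hμ hμ1).mem_source_iff.2 (hwt1 t)) (hwt t)
  have hc : ∀ t u, ΨY.toFun t u ∈ coresComplement h := fun t u => (hcY t u).1
  have hmem' : ∀ θ : sphere (0 : EuclideanSpace ℝ (Fin 2)) 1,
      ((bBase g).incl ((shrinkTube Φ hμ hμ1).toHomeo (uDir b θ, (-η') • planeE1)) : Base g) ∈ coresComplement h := fun θ => by
    have h1 := hc 1 θ
    rwa [ΨY.map_one] at h1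
  -- concatenation: Z5's isotopy, then the `jA`-push of Y2's
  have hfr₂ := isFramingAlong_jA_push D hc hfrY
  have hKend : IsBoundaryKnot fun θ : sphere (0 : EuclideanSpace ℝ (Fin 2)) 1 =>
      ((bBase g).incl ((shrinkTube Φ hμ hμ1).toHomeo (uDir b θ, (-η') • planeE1)) : Base g) := ΨY.isBoundaryKnot_right
  have hνend : IsKnotFraming (fun θ : sphere (0 : EuclideanSpace ℝ (Fin 2)) 1 =>
      ((bBase g).incl ((shrinkTube Φ hμ hμ1).toHomeo (uDir b θ, (-η') • planeE1)) : Base g))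
      (fun θ => mfderiv 𝓘(ℝ, ℝ) (𝓡∂ 4) (fun ε : ℝ => ((bBase g).incl ((shrinkTube Φ hμ hμ1).toHomeo
        (uDir b θ, (-η') • planeE1 + ε • reflFibre s (θ : EuclideanSpace ℝ (Fin 2)))) : Base g)) 0 (1 : ℝ)) := by
    have h1 := hfrY.isKnotFraming_one
    rwa [funext hendY] at h1
  refine ⟨hKend, hνend, hmem, hmem', ΨZ.trans' (isotopyJA D ΨY hc), _, fun t θ => ?_, hfrZ.trans' ((funext hendZ) ▸ hfr₂), fun θ => ?_⟩
  · rw [KnotIsotopyInBoundary.trans'_toFun]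
    split_ifs with ht
    · exact hcZ _ θ
    · exact ⟨⟨_, hc _ θ⟩, (hcY _ θ).2, rfl⟩
  · show (if (1 : ℝ) ≤ 1 / 2 then νtZ (KnotIsotopyInBoundary.ρ₁ 1)
      else (fun t u => mfderiv (𝓡∂ 4) (𝓡∂ 4) D.jA ⟨ΨY.toFun t u, hc t u⟩ (νtY t u)) (KnotIsotopyInBoundary.ρ₂ 1)) θ = _
    rw [if_neg (by norm_num), KnotIsotopyInBoundary.ρ₂_one]
    show mfderiv (𝓡∂ 4) (𝓡∂ 4) D.jA ⟨ΨY.toFun 1 θ, hc 1 θ⟩ (νtY 1 θ) = _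
    have key : ∀ (G : sphere (0 : EuclideanSpace ℝ (Fin 2)) 1 → Base g) (hG : ∀ u, G u ∈ coresComplement h)
        (_ : G = fun θ => ((bBase g).incl ((shrinkTube Φ hμ hμ1).toHomeo (uDir b θ, (-η') • planeE1)) : Base g))
        (v : EuclideanSpace ℝ (Fin 4)),
        mfderiv (𝓡∂ 4) (𝓡∂ 4) D.jA ⟨G θ, hG θ⟩ v =
          mfderiv (𝓡∂ 4) (𝓡∂ 4) D.jA ⟨((bBase g).incl ((shrinkTube Φ hμ hμ1).toHomeo (uDir b θ, (-η') • planeE1)) : Base g), hmem' θ⟩ v := by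
      intro G hG e v; subst e; rfl
    rw [key _ (hc 1) ΨY.map_one, hendY θ]
    rfl

/-! ### §3 Registered helper (framing-free part) -/

/-- **Registered helper `helper_belt_slideToPushoff` (node T3c-1′ of NF6 `stub_steinRealisation`, assembly part 1,
wave 4, lead c5): the end knot of the belt-circle slide is isotopic in `∂X`, through knots that are `jA` of points of
`range (h j)` off the cores, to `jA` of the page push-off `θ ↦ Φ' (uDir b θ, -η' e₁)` of the shrunk page tube
`Φ' = shrinkTube Φ μ`** — the framing-free part of `exists_slideEnd_to_pushoff` (which in addition carries V6's end
framing to `d(jA)` of the push-off fibre framing `d/dε|₀ Φ' (uDir b θ, -η' e₁ + ε reflFibre s θ)`).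
[cite: Kosinski1993, III (3.5) and VI §6] -/
theorem helper_belt_slideToPushoff : 
    ∀ {X : Type} [TopologicalSpace X] [T2Space X] [ChartedSpace (EuclideanHalfSpace 4) X] [IsManifold (𝓡∂ 4) ∞ X] (g : ℕ) (l : List ((Fin g ⊕ Fin g → ℤ) × Bool)) (h : Fin l.length → Literature.Topology.FourManifolds.HandleAttachingMap 3 2 (Literature.Topology.FourManifolds.LefschetzBase.Base g)), Literature.Topology.FourManifolds.LefschetzBase.IsLefschetzLink g l h → ∀ (D : Literature.Topology.FourManifolds.HandleAttachingMap.MultiAttachmentData h (𝓡∂ 4) X) (j : Fin l.length) (κ r : ℝ) (Φ : Literature.Topology.FourManifolds.CircleTube (Literature.Topology.FourManifolds.LefschetzBase.bBase g).carrier), 0 < κ → 0 < r → (∀ ψ, (Literature.Topology.FourManifolds.LefschetzBase.bBase g).incl (Φ.core ψ) = (h j).attachingCircle ψ) → (∀ t : ℝ, HasFDerivAt (fun v : EuclideanSpace ℝ (Fin 2) => ((Literature.Topology.FourManifolds.LefschetzBase.bBase g).incl (Φ.toHomeo (Literature.Topology.FourManifolds.circlePt t, v))).1) ((EuclideanSpace.proj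 (𝕜 := ℝ) (0 : Fin 2)).smulRight (r • Literature.Topology.FourManifolds.LefschetzBase.cplxJ (deriv (Literature.Topology.FourManifolds.LefschetzBase.ambCurve g (h j).attachingCircle) t)) + (EuclideanSpace.proj (𝕜 := ℝ) (1 : Fin 2)).smulRight (κ • Summit.SmoothPoincare4.SmoothPoincare4.Theorems.AcyclicBisectionExists.ModpBraidOrbits.rotField g ((h j).attachingCircle (Literature.Topology.FourManifolds.circlePt t)).1)) 0) → ∃ (σ : ℝ) (s : ℝ) (b : Bool) (μ : ℝ) (hμ : 0 < μ) (hμ1 : μ ≤ 1) (r₀ : ℝ), σ = (if (l.get j).2 then -1 else 1) ∧ σ ^ 2 = 1 ∧ s ^ 2 = 1 ∧ σ * s * Summit.SmoothPoincare4.SmoothPoincare4.Theorems.AcyclicBisectionExists.ModpBraidOrbits.slideSign b = -1 ∧ 0 < r₀ ∧ r₀ ≤ 1 / 4 ∧ ∀ r η' : ℝ, 0 < r → r < r₀ → 0 < η' → η' < 1 → ∃ (hmem : ∀ θ : Metric.sphere (0 : EuclideanSpace ℝ (Fin 2)) 1, (h j).toFun (Summit.SmoothPoincare4.SmoothPoincare4.Theorems.AcyclicBisectionExists.ModpBraidOrbits.tubeLongitudePt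 b r θ) ∈ Literature.Topology.FourManifolds.HandleAttachingMap.coresComplement h) (hmem' : ∀ θ : Metric.sphere (0 : EuclideanSpace ℝ (Fin 2)) 1, ((Literature.Topology.FourManifolds.LefschetzBase.bBase g).incl ((Summit.SmoothPoincare4.SmoothPoincare4.Theorems.AcyclicBisectionExists.ModpBraidOrbits.shrinkTube Φ hμ hμ1).toHomeo (Summit.SmoothPoincare4.SmoothPoincare4.Theorems.AcyclicBisectionExists.ModpBraidOrbits.uDir b θ, (-η') • Literature.Topology.FourManifolds.planeE1)) : Literature.Topology.FourManifolds.LefschetzBase.Base g) ∈ Literature.Topology.FourManifolds.HandleAttachingMap.coresComplement h) (Ψ : Literature.Geometry.Symplectic.KnotIsotopyInBoundary (fun θ => D.jA ⟨(h j).toFun (Summit.SmoothPoincare4.SmoothPoincare4.Theorems.AcyclicBisectionExists.ModpBraidOrbits.tubeLongitudePt b r θ), hmem θ⟩) (fun θ => D.jA ⟨(Literature.Topology.FourManifolds.LefschetzBase.bBase g).incl ((Summit.SmoothPoincare4.SmoothPoincare4.Theorems.AcyclicBisectionExists.ModpBraidOrbits.shrinkTube Φ hμ hμ1).toHomeo (Summit.SmoothPoincare4.SmoothPoincare4.Theorems.AcyclicBisectionExists.ModpBraidOrbits.uDir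 b θ, (-η') • Literature.Topology.FourManifolds.planeE1)), hmem' θ⟩)), ∀ t θ, ∃ a : ↥(Literature.Topology.FourManifolds.HandleAttachingMap.coresComplement h), (a : Literature.Topology.FourManifolds.LefschetzBase.Base g) ∈ Set.range (h j).toFun ∧ Ψ.toFun t θ = D.jA a := by
  intro X _ _ _ _ g l h hlink D j κ r Φ hκ hr hΦcore hΦder
  obtain ⟨σ, s, b, μ, hμ, hμ1, r₀, hσj, hσ, hs, hb, -, hr₀, hr₀4, H⟩ :=
    exists_slideEnd_to_pushoff g l h hlink D j κ r Φ hκ hr hΦcore hΦder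
  refine ⟨σ, s, b, μ, hμ, hμ1, r₀, hσj, hσ, hs, hb, hr₀, hr₀4, fun r η' h0 hr0 hη0 hη1 => ?_⟩
  obtain ⟨-, -, hmem, hmem', Ψ, νt, hc, -, -⟩ := H r η' h0 hr0 hη0 hη1
  exact ⟨hmem, hmem', Ψ, hc⟩

end Summit.SmoothPoincare4.SmoothPoincare4.Theorems.AcyclicBisectionExists.ModpBraidOrbits

end
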